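import Summits.MatrixMultiplication.MatrixMultiplication.Theorems.ThresholdSubsetTriples.Negative.Packing
import Literature.Barriers.MatrixMultiplication.YoungSubgroupBarrierSTPP

/-!
# `ThresholdSubsetTriples` (crux stmt-MatrixMultiplication-10882) — negative-side support III:
# shape of a witness (balanced, rooted, size window)

* `thresholdSubsetTriples_iff_balanced`: `X ↔` for every `c > 0`, cofinally in `n`, `S_n` realizes
  `⟨N,N,N⟩` with `N > √(n!)e^{-c√n}` (packing in three rotations + heredity).
* `card_window_of_beats`: every set of a TPP triple beating scale `c` has size in
  `(√(n!)e^{-c√n}, √(n!)e^{c√n})` — hosts of order `≤ √(n!)e^{-c√n}` are excluded a priori.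
* `thresholdSubsetTriples_iff_rooted`: WLOG `1 ∈ S ∩ T ∩ U` (independent right translations,
  `tripleProductProperty_image_mul_right_iff`).
A disproof of `X` may therefore assume balanced, rooted witnesses.
-/

noncomputable section

set_option linter.dupNamespace false

open scoped BigOperators

namespace Summit.MatrixMultiplication.MatrixMultiplication.Theorems.ThresholdSubsetTriples.Negative

open Summit.MatrixMultiplication.MatrixMultiplication.Theses.SnSubsetDichotomy
open Summit.MatrixMultiplication.MatrixMultiplication.Theorems
open Literature.Combinatorics.Additive
open Literature.Computability.AlgebraicComplexity
open Literature.Barriers.MatrixMultiplication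

/-! ## §4 Balanced normal form -/

/-- `Beats[c, n, S, T, U]`: the volume condition of the crux at scale `c`,
`(n!)^{3/2}·e^{-c√n} < |S||T||U|` (local notation, no new definition). -/
local notation3 "Beats[" c ", " n ", " S ", " T ", " U "]" =>
  ((Nat.factorial n : ℕ) : ℝ) ^ ((3 : ℝ) / 2) * Real.exp (-(c * Real.sqrt ((n : ℕ) : ℝ))) <
    ((Finset.card S * Finset.card T * Finset.card U : ℕ) : ℝ)

/-- `ThresholdAt[c]`: the crux at one fixed scale `c` (local notation, as in `Packing.lean`). -/
local notation3 "ThresholdAt[" c "]" =>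
  ∀ n₀ : ℕ, ∃ n ≥ n₀, ∃ S T U : Finset (Equiv.Perm (Fin n)),
    TripleProductProperty S T U ∧ Beats[c, n, S, T, U]

/-- `ThresholdBalanced`: `X` in balanced form — `S_n` realizes `⟨N,N,N⟩` with `N > √(n!)·e^{-c√n}`,
cofinally in `n`, for every `c > 0` (local notation). -/
local notation3 "ThresholdBalanced" =>
  ∀ c : ℝ, 0 < c → ∀ n₀ : ℕ, ∃ n ≥ n₀, ∃ N : ℕ,
    RealizesTPP (Equiv.Perm (Fin n)) N N N ∧
      Real.sqrt (n.factorial : ℝ) * Real.exp (-(c * Real.sqrt (n : ℝ))) < N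

/-- `X → balanced X` (same scale `c`): a threshold triple is non-empty, packing in three rotations gives
`|S||T||U| ≤ N·n!` for `N = min(|S|,|T|,|U|)`, so `N > √(n!)e^{-c√n}`, and heredity shrinks the triple to
three `N`-sets (`tpp_perm_card_mul_le_min_mul_factorial`, `tpp_perm_realizesTPP_of_le`). -/
theorem thresholdBalanced_of_thresholdSubsetTriples (h : ThresholdSubsetTriples) :
    ThresholdBalanced := by
  intro c hc n₀
  obtain ⟨n, hn, S, T, U, hTPP, hlt⟩ := h c hc n₀
  have hprod : 0 < S.card * T.card * U.card := by
    have h0 : (0 : ℝ) < ((S.card * T.card * U.card : ℕ) : ℝ) := lt_of_le_of_lt (by positivity) hlt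
    exact_mod_cast h0
  have hS0 : S.card ≠ 0 := fun h0 => by simp [h0] at hprod
  have hT0 : T.card ≠ 0 := fun h0 => by simp [h0] at hprod
  have hU0 : U.card ≠ 0 := fun h0 => by simp [h0] at hprod
  have hNprod := tpp_perm_card_mul_le_min_mul_factorial hTPP hS0 hT0 hU0
  have hNS : min S.card (min T.card U.card) ≤ S.card := min_le_left _ _
  have hNT : min S.card (min T.card U.card) ≤ T.card := (min_le_right _ _).trans (min_le_left _ _)
  have hNU : min S.card (min T.card U.card) ≤ U.card :=
    (min_le_right _ _).trans (min_le_right _ _)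
  generalize min S.card (min T.card U.card) = N at hNprod hNS hNT hNU
  refine ⟨n, hn, N, tpp_perm_realizesTPP_of_le hTPP hNS hNT hNU, ?_⟩
  have hF : (0 : ℝ) < (n.factorial : ℝ) := by exact_mod_cast Nat.factorial_pos n
  set F : ℝ := (n.factorial : ℝ) with hFdef
  set e : ℝ := Real.exp (-(c * Real.sqrt (n : ℝ))) with hedef
  have hrpow : F ^ ((3 : ℝ) / 2) = F * Real.sqrt F := by
    rw [Real.rpow_div_two_eq_sqrt _ hF.le, Real.rpow_ofNat, pow_succ, Real.sq_sqrt hF.le]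
  have h1 : F * (Real.sqrt F * e) < F * N :=
    calc F * (Real.sqrt F * e) = F ^ ((3 : ℝ) / 2) * e := by rw [hrpow, mul_assoc]
      _ < ((S.card * T.card * U.card : ℕ) : ℝ) := hlt
      _ ≤ (N : ℝ) * F := by rw [hFdef]; exact_mod_cast hNprod
      _ = F * N := mul_comm _ _
  exact lt_of_mul_lt_mul_left h1 hF.le

/-- `balanced X → X` (scale `c/3 ↦ c`): `N³ > (√(n!)e^{-(c/3)√n})³ = (n!)^{3/2}e^{-c√n}`. -/
theorem thresholdSubsetTriples_of_thresholdBalanced (h : ThresholdBalanced) :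
    ThresholdSubsetTriples := by
  intro c hc n₀
  obtain ⟨n, hn, N, ⟨S, T, U, hS, hT, hU, hTPP⟩, hlt⟩ := h (c / 3) (by positivity) n₀
  refine ⟨n, hn, S, T, U, hTPP, ?_⟩
  have hF : (0 : ℝ) < (n.factorial : ℝ) := by exact_mod_cast Nat.factorial_pos n
  set F : ℝ := (n.factorial : ℝ) with hFdef
  have h0 : 0 ≤ Real.sqrt F * Real.exp (-(c / 3 * Real.sqrt (n : ℝ))) := by positivity
  have hcube : (Real.sqrt F * Real.exp (-(c / 3 * Real.sqrt (n : ℝ)))) ^ 3 < (N : ℝ) ^ 3 :=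
    pow_lt_pow_left₀ hlt h0 three_ne_zero
  have h3 : ((3 : ℕ) : ℝ) * -(c / 3 * Real.sqrt (n : ℝ)) = -(c * Real.sqrt (n : ℝ)) := by
    push_cast
    ring
  have hlhs : (Real.sqrt F * Real.exp (-(c / 3 * Real.sqrt (n : ℝ)))) ^ 3 =
      F ^ ((3 : ℝ) / 2) * Real.exp (-(c * Real.sqrt (n : ℝ))) := by
    rw [mul_pow, Real.rpow_div_two_eq_sqrt _ hF.le, Real.rpow_ofNat, ← Real.exp_nat_mul, h3]
  have hrhs : ((N : ℝ)) ^ 3 = ((S.card * T.card * U.card : ℕ) : ℝ) := by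
    rw [hS, hT, hU]
    push_cast
    ring
  show F ^ ((3 : ℝ) / 2) * Real.exp (-(c * Real.sqrt (n : ℝ))) < ((S.card * T.card * U.card : ℕ) : ℝ)
  rw [← hlhs, ← hrhs]
  exact hcube

/-- **Balanced normal form.** `X ↔` "for every `c > 0`, cofinally in `n`, `S_n` realizes `⟨N,N,N⟩` with
`N > √(n!)·e^{-c√n}`".  A disproof may assume `|S| = |T| = |U|`. -/
theorem thresholdSubsetTriples_iff_balanced : ThresholdSubsetTriples ↔ ThresholdBalanced :=
  ⟨thresholdBalanced_of_thresholdSubsetTriples, thresholdSubsetTriples_of_thresholdBalanced⟩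


/-- `X` along the scales `1/(k+1)` suffices (antitonicity in `c`). -/
theorem thresholdSubsetTriples_iff_nat :
    ThresholdSubsetTriples ↔ ∀ k : ℕ, ThresholdAt[1 / ((k : ℝ) + 1)] := by
  refine ⟨fun h k => h _ (by positivity), fun h c hc => ?_⟩
  obtain ⟨k, hk⟩ := exists_nat_one_div_lt hc
  exact thresholdAt_anti hk.le (h k)

/-! ### §4b Shape of a witness: balanced sizes, rooted sets -/

/-- **Size window.** In a TPP triple beating scale `c`, every set has size in
`(√(n!)·e^{-c√n}, √(n!)·e^{c√n})`: lower bound from `|S||T||U| ≤ min·n!`, upper bound from packing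
`|S||T| ≤ n!` against the lower bound for the partner.  Hosts of order `≤ √(n!)e^{-c√n}` (e.g. Young
subgroups `S_b^{n/b}` with `b = O(√n)`, order `√(n!)e^{-Ω(n)}`) can contain no set of a witness. -/
theorem card_window_of_beats {c : ℝ} {n : ℕ} {S T U : Finset (Equiv.Perm (Fin n))}
    (hTPP : TripleProductProperty S T U) (hB : Beats[c, n, S, T, U]) :
    Real.sqrt (n.factorial : ℝ) * Real.exp (-(c * Real.sqrt (n : ℝ))) < S.card ∧
      (S.card : ℝ) < Real.sqrt (n.factorial : ℝ) * Real.exp (c * Real.sqrt (n : ℝ)) := by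
  have hprod : 0 < S.card * T.card * U.card := by
    have h0 : (0 : ℝ) < ((S.card * T.card * U.card : ℕ) : ℝ) := lt_of_le_of_lt (by positivity) hB
    exact_mod_cast h0
  have hS0 : S.card ≠ 0 := fun h0 => by simp [h0] at hprod
  have hT0 : T.card ≠ 0 := fun h0 => by simp [h0] at hprod
  have hU0 : U.card ≠ 0 := fun h0 => by simp [h0] at hprod
  obtain ⟨hP1, hP2, -⟩ := tpp_perm_card_mul_card_le_factorial hTPP hS0 hT0 hU0
  have hF : (0 : ℝ) < (n.factorial : ℝ) := by exact_mod_cast Nat.factorial_pos n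
  set F : ℝ := (n.factorial : ℝ) with hFdef
  set s : ℝ := Real.sqrt (n : ℝ) with hsdef
  have hrpow : F ^ ((3 : ℝ) / 2) = F * Real.sqrt F := by
    rw [Real.rpow_div_two_eq_sqrt _ hF.le, Real.rpow_ofNat, pow_succ, Real.sq_sqrt hF.le]
  have hsqF : Real.sqrt F * Real.sqrt F = F := Real.mul_self_sqrt hF.le
  have hsqF0 : 0 < Real.sqrt F := Real.sqrt_pos.2 hF
  have hee : Real.exp (-(c * s)) * Real.exp (c * s) = 1 := by
    rw [← Real.exp_add, neg_add_cancel, Real.exp_zero]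
  -- lower bound for |S|: F^{3/2} e^{-cs} < |S| (|T||U|) ≤ |S| F
  have hlowS : Real.sqrt F * Real.exp (-(c * s)) < S.card := by
    have h1 : F * (Real.sqrt F * Real.exp (-(c * s))) < F * S.card :=
      calc F * (Real.sqrt F * Real.exp (-(c * s))) = F ^ ((3 : ℝ) / 2) * Real.exp (-(c * s)) := by
            rw [hrpow, mul_assoc]
        _ < ((S.card * T.card * U.card : ℕ) : ℝ) := hB
        _ = (S.card : ℝ) * ((T.card * U.card : ℕ) : ℝ) := by push_cast; ring
        _ ≤ (S.card : ℝ) * F := by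
            refine mul_le_mul_of_nonneg_left ?_ (Nat.cast_nonneg _)
            rw [hFdef]; exact_mod_cast hP2
        _ = F * S.card := mul_comm _ _
    exact lt_of_mul_lt_mul_left h1 hF.le
  -- lower bound for |T| (same argument on the rotated triple's packing `|U||S| ≤ n!`)
  have hlowT : Real.sqrt F * Real.exp (-(c * s)) < T.card := by
    obtain ⟨-, -, hP3⟩ := tpp_perm_card_mul_card_le_factorial hTPP hS0 hT0 hU0
    have h1 : F * (Real.sqrt F * Real.exp (-(c * s))) < F * T.card :=
      calc F * (Real.sqrt F * Real.exp (-(c * s))) = F ^ ((3 : ℝ) / 2) * Real.exp (-(c * s)) := by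
            rw [hrpow, mul_assoc]
        _ < ((S.card * T.card * U.card : ℕ) : ℝ) := hB
        _ = (T.card : ℝ) * ((U.card * S.card : ℕ) : ℝ) := by push_cast; ring
        _ ≤ (T.card : ℝ) * F := by
            refine mul_le_mul_of_nonneg_left ?_ (Nat.cast_nonneg _)
            rw [hFdef]; exact_mod_cast hP3
        _ = F * T.card := mul_comm _ _
    exact lt_of_mul_lt_mul_left h1 hF.le
  refine ⟨hlowS, ?_⟩
  -- upper bound: |S||T| ≤ F and |T| > √F e^{-cs}
  have hT0' : (0 : ℝ) < T.card := lt_of_le_of_lt (by positivity) hlowT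
  have hST : (S.card : ℝ) * T.card ≤ F := by rw [hFdef]; exact_mod_cast hP1
  by_contra hge
  rw [not_lt] at hge
  have h2 : Real.sqrt F * Real.exp (c * s) * (Real.sqrt F * Real.exp (-(c * s))) <
      (S.card : ℝ) * T.card := by
    calc Real.sqrt F * Real.exp (c * s) * (Real.sqrt F * Real.exp (-(c * s)))
        < Real.sqrt F * Real.exp (c * s) * T.card := mul_lt_mul_of_pos_left hlowT (by positivity)
      _ ≤ (S.card : ℝ) * T.card := mul_le_mul_of_nonneg_right hge hT0'.le
  have h3 : Real.sqrt F * Real.exp (c * s) * (Real.sqrt F * Real.exp (-(c * s))) = F := by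
    calc Real.sqrt F * Real.exp (c * s) * (Real.sqrt F * Real.exp (-(c * s)))
        = (Real.sqrt F * Real.sqrt F) * (Real.exp (-(c * s)) * Real.exp (c * s)) := by ring
      _ = F := by rw [hsqF, hee, mul_one]
  linarith

/-- `ThresholdRooted`: `X` with the witnesses normalised to contain the identity (local notation). -/
local notation3 "ThresholdRooted" =>
  ∀ c : ℝ, 0 < c → ∀ n₀ : ℕ, ∃ n ≥ n₀, ∃ S T U : Finset (Equiv.Perm (Fin n)),
    (1 ∈ S ∧ 1 ∈ T ∧ 1 ∈ U) ∧ TripleProductProperty S T U ∧ Beats[c, n, S, T, U]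

/-- **Rooted normal form**: `X ↔ ThresholdRooted` (right-translate each set by the inverse of one of
its elements; the TPP is invariant under independent right translations,
`tripleProductProperty_image_mul_right_iff`, and cardinalities are unchanged).  Together with §4 a
disproof may assume `1 ∈ S ∩ T ∩ U` (and, separately, `|S| = |T| = |U|`). -/
theorem thresholdSubsetTriples_iff_rooted : ThresholdSubsetTriples ↔ ThresholdRooted := by
  refine ⟨fun h c hc n₀ => ?_, fun h c hc n₀ => ?_⟩
  · obtain ⟨n, hn, S, T, U, hTPP, hB⟩ := h c hc n₀
    have hprod : 0 < S.card * T.card * U.card := by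
      have h0 : (0 : ℝ) < ((S.card * T.card * U.card : ℕ) : ℝ) := lt_of_le_of_lt (by positivity) hB
      exact_mod_cast h0
    obtain ⟨s₀, hs₀⟩ : S.Nonempty :=
      Finset.card_pos.1 (Nat.pos_of_ne_zero fun h0 => by simp [h0] at hprod)
    obtain ⟨t₀, ht₀⟩ : T.Nonempty :=
      Finset.card_pos.1 (Nat.pos_of_ne_zero fun h0 => by simp [h0] at hprod)
    obtain ⟨u₀, hu₀⟩ : U.Nonempty :=
      Finset.card_pos.1 (Nat.pos_of_ne_zero fun h0 => by simp [h0] at hprod)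
    refine ⟨n, hn, S.image (· * s₀⁻¹), T.image (· * t₀⁻¹), U.image (· * u₀⁻¹), ⟨?_, ?_, ?_⟩,
      (tripleProductProperty_image_mul_right_iff S T U _ _ _).2 hTPP, ?_⟩
    · exact Finset.mem_image.2 ⟨s₀, hs₀, mul_inv_cancel s₀⟩
    · exact Finset.mem_image.2 ⟨t₀, ht₀, mul_inv_cancel t₀⟩
    · exact Finset.mem_image.2 ⟨u₀, hu₀, mul_inv_cancel u₀⟩
    · rwa [Finset.card_image_of_injective _ (mul_left_injective _),
        Finset.card_image_of_injective _ (mul_left_injective _),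
        Finset.card_image_of_injective _ (mul_left_injective _)]
  · obtain ⟨n, hn, S, T, U, -, hTPP, hB⟩ := h c hc n₀
    exact ⟨n, hn, S, T, U, hTPP, hB⟩


end Summit.MatrixMultiplication.MatrixMultiplication.Theorems.ThresholdSubsetTriples.Negative

end
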